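import Literature.Topology.FourManifolds.BandSumConcordanceLeftProofs
import HarnessLib

/-!
# Concordance of connected sums: existence of `#` discharged, and the exact remaining input

Sibling file of `BandSumConcordance.lean` (topic `Literature/Topology/FourManifolds`), in the
proof programme of the named facts

* `Literature.Topology.FourManifolds.Knot.exists_isConnectedSum_isConcordant`
  (`BandSumConcordance.lean`: the connected sum of two concordances is a concordance between
  *some* connected sums of the ends; Fox–Milnor (1966), §1), and
* `Literature.Topology.FourManifolds.Knot.IsConnectedSum.isConcordant` (`BandSum.lean`: concordance
  is a congruence for `#`, for *arbitrary* witnesses of `Knot.IsConnectedSum` on both sides).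

State of the tree used here (all proved): the one-sided carrying construction
`Knot.exists_isConnectedSum_isConcordant_left_holds` / `…_right_holds`
(`BandSumConcordanceLeftProofs.lean`), and `equivalence_isConcordant_holds`
(`ConcordanceTransitivity.lean`). Proved in this file:

* `Literature.Topology.FourManifolds.Knot.exists_isConnectedSum_holds` — **discharge** of the named
  fact `Knot.exists_isConnectedSum` of `BandSum.lean` (any two knots have a connected sum;
  Rolfsen (1976), §2.G): the carrying construction applied to the product concordance
  `K₁ ~ K₁` already produces a witness of `K₁ # K₂`.
* `Literature.Topology.FourManifolds.Knot.exists_isConnectedSum_isConcordant_of_unique` — the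
  two-sided fact follows from **uniqueness of the connected sum up to concordance**
  (`∀ K K', IsConnectedSum K₁ K₂ K → IsConnectedSum K₁ K₂ K' → K ~ K'`), a hypothesis implied
  by Schubert's uniqueness up to isotopy `Knot.IsConnectedSum.isIsotopic` used by
  `exists_isConnectedSum_isConcordant_of_schubert` (isotopic knots are concordant,
  `IsConcordant.of_isIsotopic_holds`): chain `K₁ # K₂ ~ K₁' # K₂` (first factor),
  the two witnesses of `K₁' # K₂` (hypothesis), `K₁' # K₂ ~ K₁' # K₂'` (second factor).
* `Literature.Topology.FourManifolds.Knot.IsConnectedSum.isConcordant_iff_unique` — the full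
  Fox–Milnor congruence is **equivalent** to uniqueness of `#` up to concordance (its diagonal
  `K₁ = K₁'`, `K₂ = K₂'`), unconditionally; and
  `Literature.Topology.FourManifolds.Knot.exists_isConnectedSum_isConcordant_of_isConcordant'` — the
  two-sided fact follows from the congruence alone (the existence hypothesis of
  `exists_isConnectedSum_isConcordant_of_isConcordant` being discharged).

So the remaining content of both named facts is a uniqueness statement for `K₁ # K₂` up to
concordance. The one-sided theorems alone do not give the two-sided fact: every concordance the
carrying construction produces keeps its small summand fixed, so any chain from a witness of
`K₁ # K₂` to a witness of `K₁' # K₂'` must identify, at some junction, two *different* witnesses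
of `K₁' # K₂` (one with `K₂` small, one with `K₁'` small). For *arbitrary* witnesses this is
Schubert's theorem (`IsConnectedSum.isIsotopic`, reduced in `ConnectedSumNormalForm.lean` to the
Schoenflies theorem in `𝕊³` and `Knot.Schubert1949_normalPosition`); for the witnesses the
carrying construction actually produces — which `KnotPiece.InTube.isConnectedSum_of_transport`
(`BandSumNormalTransport.lean`) obtains from *normal* presentations
(`Knot.IsNormalConnectedSum`) — Schubert's theorem in normal position suffices (sequel file).

## References

* R. H. Fox, J. W. Milnor, *Singularities of 2-spheres in 4-space and cobordism of knots*,
  Osaka J. Math. 3 (1966), 257–267, §1. [FoxMilnor1966]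
* D. Rolfsen, *Knots and Links* (1976), §2.G (connected sum). [Rolfsen1976]
* C. Livingston, *A survey of classical knot concordance*, Handbook of Knot Theory (2005),
  §2.1, Thm. 2.2. [Livingston2005]

## Design notes

No statement of another file is modified; no named fact is introduced (the uniqueness
hypothesis is an explicit binder of the two reduction theorems, never asserted); no `sorry`.
-/

noncomputable section

namespace Literature.Topology.FourManifolds

namespace Knot

/-- **Existence of connected sums** — discharge of the named fact `Knot.exists_isConnectedSum`
(`BandSum.lean`): any two knots `K₁`, `K₂` have a connected sum `K₁ # K₂`. The carrying
construction `exists_isConnectedSum_isConcordant_left_holds`, applied to the product concordance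
`K₁ ~ K₁` (`equivalence_isConcordant_holds`), yields in particular a knot `K` with
`IsConnectedSum K₁ K₂ K` (a small copy of `K₂` tied into `K₁` inside a tube about an arc of
`K₁`, split from the rest of `K₁` by the boundary sphere of the tube end). Rolfsen (1976), §2.G;
Burde–Zieschang (2003), Def. 2.7. [cite: Rolfsen1976, §2.G] -/
theorem exists_isConnectedSum_holds : exists_isConnectedSum := by
  intro K₁ K₂
  obtain ⟨K, -, hK, -, -⟩ :=
    exists_isConnectedSum_isConcordant_left_holds K₂ (equivalence_isConcordant_holds.refl K₁)
  exact ⟨K, hK⟩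

/-- **The connected sum of concordances from uniqueness of `#` up to concordance.** If any two
connected sums of the same two knots are concordant, then concordances `K₁ ~ K₁'`, `K₂ ~ K₂'`
give concordant connected sums `K₁ # K₂ ~ K₁' # K₂'` (for some witnesses): chain the first-factor
construction `K₁ # K₂ ~ K₁' # K₂` (`exists_isConnectedSum_isConcordant_left_holds`), the
hypothesis between the two witnesses of `K₁' # K₂`, and the second-factor construction
`K₁' # K₂ ~ K₁' # K₂'` (`exists_isConnectedSum_isConcordant_right_holds`). The hypothesis is the
diagonal of the congruence `IsConnectedSum.isConcordant` and is implied by Schubert's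
`IsConnectedSum.isIsotopic` (cf. `exists_isConnectedSum_isConcordant_of_schubert`).
Fox–Milnor (1966), §1; Livingston (2005), Thm. 2.2. [cite: FoxMilnor1966, §1] -/
theorem exists_isConnectedSum_isConcordant_of_unique
    (huniq : ∀ {K₁ K₂ K K' : Knot}, IsConnectedSum K₁ K₂ K → IsConnectedSum K₁ K₂ K' →
      K.IsConcordant K') :
    exists_isConnectedSum_isConcordant := by
  intro K₁ K₂ K₁' K₂' h₁ h₂
  obtain ⟨L, L', hL, hL', hc⟩ := exists_isConnectedSum_isConcordant_left_holds K₂ h₁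
  obtain ⟨M, M', hM, hM', hc'⟩ := exists_isConnectedSum_isConcordant_right_holds K₁' h₂
  exact ⟨L, M', hL, hM', equivalence_isConcordant_holds.trans hc
    (equivalence_isConcordant_holds.trans (huniq hL' hM) hc')⟩

/-- **The Fox–Milnor congruence is equivalent to uniqueness of `#` up to concordance.**
Concordance is a congruence for the connected sum with arbitrary witnesses
(`IsConnectedSum.isConcordant`) iff any two connected sums of the same two knots are concordant:
`→` is the diagonal case (reflexivity of concordance, `equivalence_isConcordant_holds`); `←`
chains the hypothesis at both ends of the connected sum of concordances
`exists_isConnectedSum_isConcordant_of_unique`. Fox–Milnor (1966), §1; Livingston (2005),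
Thm. 2.2. [cite: FoxMilnor1966, §1] -/
theorem IsConnectedSum.isConcordant_iff_unique :
    IsConnectedSum.isConcordant ↔
      ∀ {K₁ K₂ K K' : Knot}, IsConnectedSum K₁ K₂ K → IsConnectedSum K₁ K₂ K' →
        K.IsConcordant K' := by
  constructor
  · intro h K₁ K₂ K K' hK hK'
    exact h hK hK' (equivalence_isConcordant_holds.refl K₁) (equivalence_isConcordant_holds.refl K₂)
  · intro huniq K₁ K₂ K₁' K₂' K K' hK hK' h₁ h₂
    obtain ⟨L, L', hL, hL', hc⟩ := exists_isConnectedSum_isConcordant_of_unique huniq h₁ h₂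
    exact equivalence_isConcordant_holds.trans (huniq hK hL)
      (equivalence_isConcordant_holds.trans hc (huniq hL' hK'))

/-- The connected sum of concordances `exists_isConnectedSum_isConcordant` follows from the
congruence `IsConnectedSum.isConcordant` alone (`exists_isConnectedSum_isConcordant_of_isConcordant`
with its existence hypothesis discharged by `exists_isConnectedSum_holds`); in particular the
former named fact is not stronger than the latter. [folklore] -/
theorem exists_isConnectedSum_isConcordant_of_isConcordant' (hcong : IsConnectedSum.isConcordant) :
    exists_isConnectedSum_isConcordant :=
  exists_isConnectedSum_isConcordant_of_isConcordant hcong exists_isConnectedSum_holds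

end Knot

end Literature.Topology.FourManifolds
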